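import Literature.AlgebraicGeometry.HodgeTheory.QuaternionicQuarticDeckChartEtaleEquiv
import Literature.AlgebraicGeometry.HodgeTheory.QuaternionicQuarticPrimeSpecialisation
import HarnessLib

/-!
# The étale chart of the normalised quaternionic quartic cover is INTEGRAL at every injective point of the
# parameter ring (programme «M1», brick M1-0a″)

Layer `Literature/AlgebraicGeometry/HodgeTheory`. Theorems (no named fact, no new definition of substance). Written by
the prover seat `hodge-nonav-prover-Bx` (g19, cell `hodge-nonav`), programme M1 (memo `PROGRAMME-M1-Bx-g19.md`) for
route `HodgeConjecture/Q8SymplecticPowers` (crux K1Q, stmt-HodgeConjecture-24190). Sequel of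
`QuaternionicQuarticDeckChartEtaleEquiv` (`isDomain_deckRing_of_prime`: the chart ring over a field is a domain as
soon as `X⁴ − g` is prime in `K[u₀, u₁][X]` and `h ≠ 0`) and of `QuaternionicQuarticPrimeSpecialisation` (the
witnesses `wit₁ = (a₂, 0, −a₀)`, `eval_wit₁_univΨ_ne_zero`, … of seat 19716-p2).

Main result: for `A = ℂ[a]` the parameter ring and an INJECTIVE ring map `φ : A → L` into a field containing `ℂ`
(e.g. the generic point `A ↪ Frac A`), with `a_φ = φ ∘ X` the tautological coefficient vector and `e ≥ 2`:

* `prime_c₂` — the dehomogenised linear form `c = a₀ u₀ + a₁ u₁ + a₂` is prime in `L[u₀, u₁]` (total degree `1`,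
  Mathlib `irreducible_of_totalDegree_eq_one`);
* `not_c₂_dvd_c₂'`, `not_c₂_dvd_α₂`, `not_c₂_dvd_ψ₂` — `c ∤ σc, α, ψ`: the zero `z = (−a₂/a₀, 0)` of `c` (the
  dehomogenisation of the witness `wit₁`) is not a zero of `σc, α, ψ`; the values are the homogeneous witness values
  of `QuaternionicQuarticPrimeSpecialisation` up to the factor `(−a₀)^{deg}` (`IsHomogeneous.eval_smul_eq`);
* `prime_X_pow_four_sub_C_g₂` — `X⁴ − g` is prime in `L[u₀, u₁][X]` (Eisenstein at `c`, the tree's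
  `irreducible_C_mul_X_pow_sub_C` of QF-1a);
* **`isDomain_deckRing_of_injective`** — the chart ring `DeckRing a_φ` is a domain; with `isRegularRing_deckRing`
  this makes `Spec (DeckRing a_φ)` an integral regular affine `L`-scheme of finite type (the input `U` of the
  equivariant projective completion, brick M1-2).

Honest scope: explicit commutative algebra for one family of surfaces; nothing here bears on HC.

## References

* [Lang2002] S. Lang, Algebra (3rd ed., 2002), Ch. IV §1 (evaluation, homogeneity), §3 Thm. 3.1 (Eisenstein).
* [Kollar2007] J. Kollár, Lectures on Resolution of Singularities (2007), §3.3.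
* [StacksProject] The Stacks Project, Tag 00UB.
-/

noncomputable section

open MvPolynomial

namespace Literature.AlgebraicGeometry.HodgeTheory.Q8Family

universe v

/-! ### Dehomogenisation: change of coefficients, evaluation, homogeneous scaling -/

section Dehom

variable {R : Type v} [CommRing R] {S : Type v} [CommRing S]

/-- `dehom₂` commutes with a change of coefficients. [cite: Lang2002, Ch. IV §1 (functoriality of polynomial rings in the coefficients)] -/
theorem dehom₂_map (φ : R →+* S) (p : MvPolynomial (Fin 3) R) :
    dehom₂ (map φ p) = map φ (dehom₂ p) := by
  have key : ((dehom₂ (R := S) : MvPolynomial (Fin 3) S →+* MvPolynomial (Fin 2) S)).comp (map φ) =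
      (map φ).comp (dehom₂ (R := R) : MvPolynomial (Fin 3) R →+* MvPolynomial (Fin 2) R) := by
    refine MvPolynomial.ringHom_ext (fun r => ?_) (fun i => ?_)
    · simp [dehom₂]
    · fin_cases i <;> simp [dehom₂]
  exact DFunLike.congr_fun key p

/-- Evaluating a dehomogenised form: `(dehom₂ p)(z₀, z₁) = p(z₀, z₁, 1)`. [cite: Lang2002, Ch. IV §1 (evaluation homomorphism)] -/
theorem eval_dehom₂ (z : Fin 2 → R) (p : MvPolynomial (Fin 3) R) :
    eval z (dehom₂ p) = eval ![z 0, z 1, 1] p := by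
  have key : (eval z).comp (dehom₂ (R := R) : MvPolynomial (Fin 3) R →+* MvPolynomial (Fin 2) R) =
      eval ![z 0, z 1, 1] := by
    refine MvPolynomial.ringHom_ext (fun r => ?_) (fun i => ?_)
    · simp [dehom₂]
    · fin_cases i <;> simp [dehom₂]
  exact DFunLike.congr_fun key p

/-- **Homogeneous scaling**: `p(c • v) = c^m · p(v)` for `p` homogeneous of degree `m`.
[cite: Lang2002, Ch. IV §1 (homogeneous polynomials)] -/
theorem IsHomogeneous.eval_smul_eq {σ : Type*} {p : MvPolynomial σ R} {m : ℕ} (hp : p.IsHomogeneous m) (c : R)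
    (v : σ → R) : eval (c • v) p = c ^ m * eval v p := by
  classical
  conv_lhs => rw [p.as_sum]
  conv_rhs => rw [p.as_sum]
  rw [map_sum, map_sum, Finset.mul_sum]
  refine Finset.sum_congr rfl fun d hd => ?_
  have hdeg : d.sum (fun _ k => k) = m := by
    have := hp (mem_support_iff.mp hd)
    simpa only [Finsupp.weight_apply, Pi.one_apply, smul_eq_mul, mul_one, one_mul] using this
  rw [eval_monomial, eval_monomial, Finsupp.prod, Finsupp.prod]
  simp only [Pi.smul_apply, smul_eq_mul, mul_pow, Finset.prod_mul_distrib, Finset.prod_pow_eq_pow_sum]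
  rw [show (∑ i ∈ d.support, d i) = m from hdeg]
  ring

end Dehom

/-! ### The generic coefficient vector: primality of `c`, the witness point, `c ∤ σc, α, ψ` -/

section Generic

variable {e : ℕ} {L : Type} [Field L] (φ : ParamRing e →+* L)

/-- The tautological coefficient vector at the point `φ : A → L`. [cite: Kollar2007, §3.3] -/
abbrev aφ : CIdx e → L := fun i => φ (X i)

/-- `c₂` at `φ` is `φ` applied to the dehomogenised universal linear form. [cite: Lang2002, Ch. IV §1 (functoriality of polynomial rings in the coefficients)] -/
theorem c₂_aφ : c₂ (aφ φ) = map φ (dehom₂ (univC e)) := by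
  rw [c₂, cOfR_apply_eq_map, dehom₂_map]

/-- `c₂'` at `φ`. [cite: Lang2002, Ch. IV §1 (functoriality of polynomial rings in the coefficients)] -/
theorem c₂'_aφ : c₂' (aφ φ) = map φ (dehom₂ (rename (Equiv.swap (0 : Fin 3) 1) (univC e))) := by
  rw [c₂', cOfR_apply_eq_map, ← map_rename, dehom₂_map]

/-- `ψ₂` at `φ`. [cite: Lang2002, Ch. IV §1 (functoriality of polynomial rings in the coefficients)] -/
theorem ψ₂_aφ : ψ₂ (aφ φ) = map φ (dehom₂ (univΨ e)) := by
  rw [ψ₂, ψOfR_apply_eq_map, dehom₂_map]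

/-- **`c₂ = a₀ u₀ + a₁ u₁ + a₂`** explicitly. [cite: Kollar2007, §3.3] -/
theorem c₂_eq (a : CIdx e → L) :
    c₂ a = C (a (Sum.inl (linIdx 0))) * X 0 + C (a (Sum.inl (linIdx 1))) * X 1 + C (a (Sum.inl (linIdx 2))) := by
  rw [c₂, cOfR_eq_sum, map_sum, Fin.sum_univ_three]
  simp [dehom₂]

/-- **The dehomogenised linear form `c` is PRIME in `L[u₀, u₁]`** when `a₀ ≠ 0` (total degree `1` with a unit
coefficient; `L[u₀, u₁]` is factorial). [cite: Lang2002, Ch. IV §1 (degree of a product over an integral domain)] -/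
theorem prime_c₂ (a : CIdx e → L) (h0 : a (Sum.inl (linIdx 0)) ≠ 0) : Prime (c₂ a) := by
  classical
  have hcoeff : coeff (Finsupp.single 0 1) (c₂ a) = a (Sum.inl (linIdx 0)) := by
    have h10 : (Finsupp.single (1 : Fin 2) 1 : Fin 2 →₀ ℕ) ≠ Finsupp.single 0 1 := fun h =>
      absurd (Finsupp.single_left_injective one_ne_zero h) (by decide)
    have h00 : (0 : Fin 2 →₀ ℕ) ≠ Finsupp.single 0 1 := (Finsupp.single_ne_zero.mpr one_ne_zero).symm
    rw [c₂_eq]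
    simp only [coeff_add, coeff_C_mul, coeff_X, coeff_C, if_true, if_neg h10, if_neg h00, mul_one,
      mul_zero, add_zero]
  have hmem : Finsupp.single (0 : Fin 2) 1 ∈ (c₂ a).support := by
    rw [mem_support_iff, hcoeff]; exact h0
  have hdeg : (c₂ a).totalDegree = 1 := by
    apply le_antisymm
    · rw [c₂_eq]
      refine (totalDegree_add _ _).trans (max_le ((totalDegree_add _ _).trans (max_le ?_ ?_)) ?_)
      · exact (totalDegree_mul _ _).trans (by rw [totalDegree_C, totalDegree_X, zero_add])
      · exact (totalDegree_mul _ _).trans (by rw [totalDegree_C, totalDegree_X, zero_add])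
      · rw [totalDegree_C]; exact zero_le_one
    · have := le_totalDegree hmem
      simpa using this
  refine (irreducible_of_totalDegree_eq_one hdeg fun x hx => ?_).prime
  have hdvd := hx (Finsupp.single 0 1)
  rw [hcoeff] at hdvd
  exact isUnit_iff_ne_zero.mpr fun hx0 => h0 (zero_dvd_iff.mp (hx0 ▸ hdvd))

/-- The witness point `z = (a₂/(−a₀), 0) ∈ L²` — the dehomogenisation of `wit₁ = (a₂, 0, −a₀)`.
[cite: Kollar2007, §3.3] -/
def zφ : Fin 2 → L := ![φ (aLin e 2) / (-φ (aLin e 0)), 0]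

/-- **Witness transfer**: for a homogeneous `q ∈ A[x₀, x₁, x₂]` of degree `m`,
`(−a₀)^m · (dehom q)_φ(z) = φ(q(wit₁))`. [cite: Lang2002, Ch. IV §1 (homogeneous polynomials)] -/
theorem eval_zφ_dehom₂ {q : MvPolynomial (Fin 3) (ParamRing e)} {m : ℕ} (hq : q.IsHomogeneous m)
    (h0 : φ (aLin e 0) ≠ 0) :
    (-φ (aLin e 0)) ^ m * eval (zφ φ) (dehom₂ (map φ q)) = φ (eval (wit₁ e) q) := by
  have hv : (-φ (aLin e 0)) • (![zφ φ 0, zφ φ 1, 1] : Fin 3 → L) = φ ∘ wit₁ e := by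
    funext i
    fin_cases i
    · change -φ (aLin e 0) * (φ (aLin e 2) / -φ (aLin e 0)) = φ (aLin e 2)
      field_simp
    · simp [zφ]
    · simp [zφ]
  rw [eval_dehom₂, ← IsHomogeneous.eval_smul_eq (hq.map φ), hv, apply_eval_eq_eval_map]

/-- `c` vanishes at `z`. [cite: Kollar2007, §3.3] -/
theorem eval_zφ_c₂ (h0 : φ (aLin e 0) ≠ 0) : eval (zφ φ) (c₂ (aφ φ)) = 0 := by
  have h := eval_zφ_dehom₂ φ (isHomogeneous_cOfR fun i => (X i : ParamRing e)) h0
  rw [pow_one, eval_wit₁_univC, map_zero, mul_eq_zero] at h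
  rw [c₂_aφ, ← dehom₂_map]
  exact h.resolve_left (neg_ne_zero.mpr h0)

/-- `σc` does not vanish at `z` (its witness value is `a₂ (a₁ − a₀)`). [cite: Kollar2007, §3.3] -/
theorem eval_zφ_c₂'_ne_zero (h0 : φ (aLin e 0) ≠ 0) (h2 : φ (aLin e 2) ≠ 0) (h10 : φ (aLin e 1 - aLin e 0) ≠ 0) :
    eval (zφ φ) (c₂' (aφ φ)) ≠ 0 := by
  intro hz
  have h := eval_zφ_dehom₂ φ ((isHomogeneous_cOfR fun i => (X i : ParamRing e)).rename_isHomogeneous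
    (f := Equiv.swap (0 : Fin 3) 1)) h0
  rw [c₂'_aφ, ← dehom₂_map] at hz
  rw [hz, mul_zero, eval_wit₁_rename_univC, map_mul] at h
  exact mul_ne_zero h2 h10 h.symm

/-- `α` does not vanish at `z`. [cite: Kollar2007, §3.3] -/
theorem eval_zφ_α₂_ne_zero (h0 : φ (aLin e 0) ≠ 0) (h2 : φ (aLin e 2) ≠ 0) :
    eval (zφ φ) (α₂ : MvPolynomial (Fin 2) L) ≠ 0 := by
  simp only [α₂, map_sub, eval_X, zφ, Matrix.cons_val_zero, Matrix.cons_val_one, Matrix.cons_val_fin_one,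
    sub_zero]
  exact div_ne_zero h2 (neg_ne_zero.mpr h0)

/-- `ψ` does not vanish at `z` (`e ≥ 2`; its witness value `ψ̂(wit₁) ≠ 0` is 19716-p2's `eval_wit₁_univΨ_ne_zero`).
[cite: Kollar2007, §3.3] -/
theorem eval_zφ_ψ₂_ne_zero (hφ : Function.Injective φ) (he : 2 ≤ e) (h0 : φ (aLin e 0) ≠ 0) :
    eval (zφ φ) (ψ₂ (aφ φ)) ≠ 0 := by
  intro hz
  have h := eval_zφ_dehom₂ φ (isHomogeneous_ψOfR fun i => (X i : ParamRing e)) h0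
  rw [ψ₂_aφ, ← dehom₂_map] at hz
  rw [hz, mul_zero] at h
  exact (map_ne_zero_iff φ hφ).mpr (eval_wit₁_univΨ_ne_zero e he) h.symm

variable (hφ : Function.Injective φ) (he : 2 ≤ e)
include hφ

/-- `φ(a_j) ≠ 0` at an injective point. [folklore] -/
private theorem φ_aLin_ne_zero (j : Fin 3) : φ (aLin e j) ≠ 0 :=
  (map_ne_zero_iff φ hφ).mpr (aLin_ne_zero e j)

/-- `φ(a₁ − a₀) ≠ 0` at an injective point. [folklore] -/
private theorem φ_aLin_sub_ne_zero : φ (aLin e 1 - aLin e 0) ≠ 0 :=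
  (map_ne_zero_iff φ hφ).mpr (aLin_one_sub_aLin_zero_ne_zero e)

/-- At an injective point, `c` is prime in `L[u₀, u₁]`. [cite: Lang2002, Ch. IV §1 (degree of a product over an integral domain)] -/
theorem prime_c₂_aφ : Prime (c₂ (aφ φ)) :=
  prime_c₂ _ (φ_aLin_ne_zero φ hφ 0)

/-- `c ∤ σc`. [cite: Kollar2007, §3.3] -/
theorem not_c₂_dvd_c₂' : ¬ c₂ (aφ φ) ∣ c₂' (aφ φ) :=
  not_dvd_of_eval_ne_zero (zφ φ) (eval_zφ_c₂ φ (φ_aLin_ne_zero φ hφ 0))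
    (eval_zφ_c₂'_ne_zero φ (φ_aLin_ne_zero φ hφ 0) (φ_aLin_ne_zero φ hφ 2) (φ_aLin_sub_ne_zero φ hφ))

/-- `c ∤ α`. [cite: Kollar2007, §3.3] -/
theorem not_c₂_dvd_α₂ : ¬ c₂ (aφ φ) ∣ (α₂ : MvPolynomial (Fin 2) L) :=
  not_dvd_of_eval_ne_zero (zφ φ) (eval_zφ_c₂ φ (φ_aLin_ne_zero φ hφ 0))
    (eval_zφ_α₂_ne_zero φ (φ_aLin_ne_zero φ hφ 0) (φ_aLin_ne_zero φ hφ 2))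

include he in
/-- `c ∤ ψ`. [cite: Kollar2007, §3.3] -/
theorem not_c₂_dvd_ψ₂ : ¬ c₂ (aφ φ) ∣ ψ₂ (aφ φ) :=
  not_dvd_of_eval_ne_zero (zφ φ) (eval_zφ_c₂ φ (φ_aLin_ne_zero φ hφ 0))
    (eval_zφ_ψ₂_ne_zero φ hφ he (φ_aLin_ne_zero φ hφ 0))

include he in
/-- `h = c σc α ψ ≠ 0` at an injective point. [cite: Kollar2007, §3.3] -/
theorem h₂_aφ_ne_zero : h₂ (aφ φ) ≠ 0 := by
  have h0 := φ_aLin_ne_zero φ hφ 0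
  have hc : c₂ (aφ φ) ≠ 0 := (prime_c₂_aφ φ hφ).ne_zero
  have hc' : c₂' (aφ φ) ≠ 0 := fun h =>
    eval_zφ_c₂'_ne_zero φ h0 (φ_aLin_ne_zero φ hφ 2) (φ_aLin_sub_ne_zero φ hφ) (by rw [h, map_zero])
  have hα : (α₂ : MvPolynomial (Fin 2) L) ≠ 0 := fun h =>
    eval_zφ_α₂_ne_zero φ h0 (φ_aLin_ne_zero φ hφ 2) (by rw [h, map_zero])
  have hψ : ψ₂ (aφ φ) ≠ 0 := fun h => eval_zφ_ψ₂_ne_zero φ hφ he h0 (by rw [h, map_zero])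
  simp only [h₂]
  exact mul_ne_zero (mul_ne_zero (mul_ne_zero hc hc') hα) hψ

include he in
/-- **`X⁴ − g` is PRIME in `L[u₀, u₁][X]` at an injective point** (Eisenstein at the prime `c`: `c ∣ g`,
`c² ∤ g` because `c ∤ σc, α, ψ`). [cite: Lang2002, Ch. IV §3 Thm. 3.1] -/
theorem prime_X_pow_four_sub_C_g₂ :
    Prime (Polynomial.X ^ 4 - Polynomial.C (g₂ (aφ φ)) : Polynomial (MvPolynomial (Fin 2) L)) := by
  have hc := prime_c₂_aφ φ hφ
  have hirr : Irreducible (Polynomial.C (1 : MvPolynomial (Fin 2) L) * Polynomial.X ^ 4 -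
      Polynomial.C (g₂ (aφ φ))) := by
    refine irreducible_C_mul_X_pow_sub_C hc (fun h => hc.not_unit (isUnit_of_dvd_one h)) ?_ ?_
      (fun r hr _ => isUnit_of_dvd_one hr)
    · exact ⟨c₂' (aφ φ) ^ 3 * α₂ ^ 2 * ψ₂ (aφ φ) ^ 2, by simp only [g₂]; ring⟩
    · rintro ⟨q, hq⟩
      simp only [g₂] at hq
      have h1 : c₂ (aφ φ) * (c₂' (aφ φ) ^ 3 * α₂ ^ 2 * ψ₂ (aφ φ) ^ 2) = c₂ (aφ φ) * (c₂ (aφ φ) * q) := by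
        linear_combination hq
      have h2 : c₂ (aφ φ) ∣ c₂' (aφ φ) ^ 3 * α₂ ^ 2 * ψ₂ (aφ φ) ^ 2 :=
        ⟨q, mul_left_cancel₀ hc.ne_zero h1⟩
      rcases hc.dvd_or_dvd h2 with h3 | h3
      · rcases hc.dvd_or_dvd h3 with h4 | h4
        · exact not_c₂_dvd_c₂' φ hφ (hc.dvd_of_dvd_pow h4)
        · exact not_c₂_dvd_α₂ φ hφ (hc.dvd_of_dvd_pow h4)
      · exact not_c₂_dvd_ψ₂ φ hφ he (hc.dvd_of_dvd_pow h3)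
  rw [map_one, one_mul] at hirr
  exact hirr.prime

variable [Algebra ℂ L]
include he in
/-- **The étale chart of the normalised quaternionic quartic cover is INTEGRAL at every injective point of the
parameter ring** (in particular at the generic point `A ↪ Frac A`): `DeckRing a_φ` is a domain.
[cite: StacksProject, Tag 00UB] -/
theorem isDomain_deckRing_of_injective : IsDomain (DeckRing (aφ φ)) :=
  isDomain_deckRing_of_prime _ (prime_X_pow_four_sub_C_g₂ φ hφ he) (h₂_aφ_ne_zero φ hφ he)

end Generic

end Literature.AlgebraicGeometry.HodgeTheory.Q8Family

end
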